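import Summits.QuantumFields.YangMills.Theorems.ColdStartUniversalityColdStartSolutionsExistVecPicardLimit
import HarnessLib

/-!
# Route `ColdStartUniversality`, support item S (stmt-QuantumFields-24811), line `piwiener`:
# vector Picard iteration V — the limit solves the system; Itô's existence theorem for Lipschitz systems

Helper file (lead `ym-line-csu-p1`) for stub A `stub_ambientStrongExistence`; port of
`ae_picardLimit_eq_picardStep` / `isStrongSolution_picardLimit` / `exists_isStrongSolution_of_lipschitz` of the
tree's 1-D `Literature/Analysis/FunctionSpaces/ItoProcessesProofs.lean` (Revuz–Yor IX (2.1), existence half) to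
Lipschitz SYSTEMS `dX_i = b_i(X) dt + Σₙ σ_{i n}(X) dW^{c i n}` driven by the coordinates of a Brownian vector
`W` (tree `IsBrownianVec`), joint raw filtration (parts I–IV: `…VecPicardStep/Estimates/Bounds/Limit`).

* `vecPicard_lim_eq_step` — **the limit is a fixed point of the Picard step** up to indistinguishability
  (`Φ_T(X, SX) ≤ 2Φ_T(Xᵐ⁺¹, X) + 2 C T Φ_T(Xᵐ, X) → 0`);
* `exists_vecSDE_solution` — **Itô's existence theorem for Lipschitz systems driven by a Brownian
  vector**: a coordinatewise progressive, a.s. continuous, `L²(sup)` solution from every deterministic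
  initial condition, its Itô integrals square-integrable martingales of the joint raw filtration.

No definition, no sorry.  RECORD-rung plumbing; nothing here bears on the Yang–Mills mass gap. -/

set_option autoImplicit false

noncomputable section

namespace Summit.QuantumFields.YangMills.Theorems.ColdStartUniversality

open MeasureTheory ProbabilityTheory Filter Topology Finset
open scoped NNReal ENNReal BigOperators
open Literature.Probability.Process Literature.Analysis.FunctionSpaces

variable {Ω : Type*} {mΩ : MeasurableSpace Ω} {P : Measure Ω} {d : ℕ}
  {W : ℝ≥0 → Ω → (Fin d → ℝ)} {ι κ : Type*} [Fintype ι] [Fintype κ]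
  {b : (ι → ℝ) → ι → ℝ} {σ : (ι → ℝ) → ι → κ → ℝ} {c : ι → κ → Fin d} {K : ℝ} {x₀ : ι → ℝ}

section Sequence

variable [IsProbabilityMeasure P] (hW : IsBrownianVec W P) (hK : 0 ≤ K)
  (hb : ∀ x y : ι → ℝ, ∑ i, (b x i - b y i) ^ 2 ≤ K * ∑ i, (x i - y i) ^ 2)
  (hσ : ∀ x y : ι → ℝ, ∑ i, ∑ n, (σ x i n - σ y i n) ^ 2 ≤ K * ∑ i, (x i - y i) ^ 2)
  {X : ℕ → ι → ℝ≥0 → Ω → ℝ} {JX : ℕ → ι → κ → ℝ≥0 → Ω → ℝ}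
  (hX0 : ∀ i t ω, X 0 i t ω = x₀ i)
  (hXp : ∀ m i, IsStronglyProgressive hW.natFiltration (X m i))
  (hXc : ∀ m, ∀ᵐ ω ∂P, ∀ i, Continuous fun t => X m i t ω)
  (hJX : ∀ m i n, IsItoIntegral (fun s ω => σ (fun j => X m j s ω) i n) (fun s ω => W s ω (c i n)) (JX m i n)
      hW.natFiltration P ∧ IsStronglyProgressive hW.natFiltration (JX m i n))
  (hXs : ∀ m i t ω, X (m + 1) i t ω =
      x₀ i + timeIntegral (fun s ω => b (fun j => X m j s ω) i) t ω + ∑ n, JX m i n t ω)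

include hW hK hb hσ hX0 hXp hXc hJX hXs

/-- **The Picard limit is a fixed point of the Picard step**, up to indistinguishability: if `(V, JV)` is a
Picard step of the limit process `X_∞ = limUnder Xᵐ`, then a.s. `X_∞ = V` at all times
(`Φ_T(X_∞, V) ≤ 2Φ_T(Xᵐ⁺¹, X_∞) + 2 C |[0,T]| Φ_T(Xᵐ, X_∞) → 0`, then rational times and continuity).
Port of `ae_picardLimit_eq_picardStep`. Revuz–Yor (1999), Ch. IX, proof of Thm (2.1). [folklore] -/
theorem vecPicard_lim_eq_step {V : ι → ℝ≥0 → Ω → ℝ} {JV : ι → κ → ℝ≥0 → Ω → ℝ}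
    (hJV : ∀ i n, IsItoIntegral (fun s ω => σ (fun j => limUnder atTop (fun m => X m j s ω)) i n)
        (fun s ω => W s ω (c i n)) (JV i n) hW.natFiltration P ∧ IsStronglyProgressive hW.natFiltration (JV i n))
    (hV : ∀ i t ω, V i t ω = x₀ i +
        timeIntegral (fun s ω => b (fun j => limUnder atTop (fun m => X m j s ω)) i) t ω + ∑ n, JV i n t ω) :
    ∀ᵐ ω ∂P, ∀ t i, limUnder atTop (fun m => X m i t ω) = V i t ω := by
  have hLp : ∀ i, IsStronglyProgressive hW.natFiltration (fun t ω => limUnder atTop (fun m => X m i t ω)) :=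
    vecPicard_isStronglyProgressive_lim hW hXp
  have hLc : ∀ᵐ ω ∂P, ∀ i, Continuous fun t => limUnder atTop (fun m => X m i t ω) :=
    (vecPicard_ae_tendsto_lim hW hK hb hσ hX0 hXp hXc hJX hXs).mono fun _ h => h.1
  have hVp := vecPicard_step_progressive (U := fun i t ω => limUnder atTop (fun m => X m i t ω))
    hW hK hb hLp (fun i n => (hJV i n).2) hV
  have hVc := vecPicard_step_continuous (U := fun i t ω => limUnder atTop (fun m => X m i t ω))
    hW hK hb hLc (fun i n => (hJV i n).1) hV
  set Cst : ℝ≥0 → ℝ≥0∞ := fun T : ℝ≥0 => (Fintype.card ι : ℝ≥0∞) * ENNReal.ofReal (2 * T * K) +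
      8 * (Fintype.card ι : ℝ≥0∞) * (Fintype.card κ : ℝ≥0∞) ^ 2 * ENNReal.ofReal K with hCst
  -- `Φ_T(X_∞, V) = 0` for every `T`
  have hzero : ∀ T : ℝ≥0, ∫⁻ ω, ⨆ s ∈ Set.Iic T, ENNReal.ofReal
      (∑ i, (limUnder atTop (fun m => X m i s ω) - V i s ω) ^ 2) ∂P = 0 := by
    intro T
    obtain ⟨hlim, hfin⟩ := vecPicard_tendsto_lintegral_iSup_sub_lim hW hK hb hσ hX0 hXp hXc hJX hXs T
    have hmeas : ∀ m, AEMeasurable (fun ω => ⨆ s ∈ Set.Iic T, ENNReal.ofReal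
        (∑ i, (X (m + 1) i s ω - limUnder atTop (fun k => X k i s ω)) ^ 2)) P := fun m =>
      vecPicard_aemeasurable_biSup (hXp (m + 1)) hLp (hXc (m + 1)) hLc T
    have hbound : ∀ m, ∫⁻ ω, ⨆ s ∈ Set.Iic T, ENNReal.ofReal
        (∑ i, (limUnder atTop (fun k => X k i s ω) - V i s ω) ^ 2) ∂P ≤
        2 * ∫⁻ ω, ⨆ s ∈ Set.Iic T, ENNReal.ofReal
          (∑ i, (X (m + 1) i s ω - limUnder atTop (fun k => X k i s ω)) ^ 2) ∂P +
        2 * (Cst T * ((volume (Set.Icc (0 : ℝ) T)) * ∫⁻ ω, ⨆ s ∈ Set.Iic T, ENNReal.ofReal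
          (∑ i, (X m i s ω - limUnder atTop (fun k => X k i s ω)) ^ 2) ∂P)) := by
      intro m
      have hcontr := vecPicard_contraction hW hK hb hσ (hXp m) (hXc m) hLp hLc (hJX m) (hXs m) hJV hV T T le_rfl
      -- pointwise splitting
      have hpt : ∀ ω, ⨆ s ∈ Set.Iic T, ENNReal.ofReal
          (∑ i, (limUnder atTop (fun k => X k i s ω) - V i s ω) ^ 2) ≤
          (2 * ⨆ s ∈ Set.Iic T, ENNReal.ofReal
            (∑ i, (X (m + 1) i s ω - limUnder atTop (fun k => X k i s ω)) ^ 2)) +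
          2 * ⨆ s ∈ Set.Iic T, ENNReal.ofReal (∑ i, (X (m + 1) i s ω - V i s ω) ^ 2) := by
        intro ω
        refine iSup₂_le fun s hs => ?_
        have h1 : ∑ i, (limUnder atTop (fun k => X k i s ω) - V i s ω) ^ 2 ≤
            2 * ∑ i, (X (m + 1) i s ω - limUnder atTop (fun k => X k i s ω)) ^ 2 +
            2 * ∑ i, (X (m + 1) i s ω - V i s ω) ^ 2 := by
          rw [Finset.mul_sum, Finset.mul_sum, ← Finset.sum_add_distrib]
          refine Finset.sum_le_sum fun i _ => ?_
          nlinarith [sq_nonneg ((X (m + 1) i s ω - limUnder atTop (fun k => X k i s ω)) +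
            (X (m + 1) i s ω - V i s ω))]
        calc _ ≤ ENNReal.ofReal (2 * ∑ i, (X (m + 1) i s ω - limUnder atTop (fun k => X k i s ω)) ^ 2 +
            2 * ∑ i, (X (m + 1) i s ω - V i s ω) ^ 2) := ENNReal.ofReal_le_ofReal h1
          _ = 2 * ENNReal.ofReal (∑ i, (X (m + 1) i s ω - limUnder atTop (fun k => X k i s ω)) ^ 2) +
              2 * ENNReal.ofReal (∑ i, (X (m + 1) i s ω - V i s ω) ^ 2) := by
              rw [ENNReal.ofReal_add (by positivity) (by positivity), ENNReal.ofReal_mul (by norm_num : (0 : ℝ) ≤ 2),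
                ENNReal.ofReal_mul (by norm_num : (0 : ℝ) ≤ 2), ENNReal.ofReal_ofNat]
          _ ≤ _ := add_le_add (mul_le_mul' le_rfl (le_iSup₂_of_le s hs le_rfl))
              (mul_le_mul' le_rfl (le_iSup₂_of_le s hs le_rfl))
      -- the time integral is bounded by the supremum
      have hIT : ∫⁻ ω, (∫⁻ r in Set.Icc (0 : ℝ) T, ENNReal.ofReal
          (∑ i, (X m i r.toNNReal ω - limUnder atTop (fun k => X k i r.toNNReal ω)) ^ 2)) ∂P ≤
          volume (Set.Icc (0 : ℝ) T) * ∫⁻ ω, ⨆ s ∈ Set.Iic T, ENNReal.ofReal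
            (∑ i, (X m i s ω - limUnder atTop (fun k => X k i s ω)) ^ 2) ∂P := by
        rw [← lintegral_const_mul' _ _ measure_Icc_lt_top.ne]
        refine lintegral_mono fun ω => ?_
        rw [mul_comm, ← setLIntegral_const]
        refine setLIntegral_mono' measurableSet_Icc fun r hr => ?_
        exact le_iSup₂_of_le (f := fun s (_ : s ∈ Set.Iic T) => ENNReal.ofReal
          (∑ i, (X m i s ω - limUnder atTop (fun k => X k i s ω)) ^ 2)) r.toNNReal
          (Set.mem_Iic.2 (Real.toNNReal_le_iff_le_coe.2 hr.2)) le_rfl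
      calc _ ≤ ∫⁻ ω, ((2 * ⨆ s ∈ Set.Iic T, ENNReal.ofReal
              (∑ i, (X (m + 1) i s ω - limUnder atTop (fun k => X k i s ω)) ^ 2)) +
            2 * ⨆ s ∈ Set.Iic T, ENNReal.ofReal (∑ i, (X (m + 1) i s ω - V i s ω) ^ 2)) ∂P :=
            lintegral_mono hpt
        _ = 2 * ∫⁻ ω, ⨆ s ∈ Set.Iic T, ENNReal.ofReal
              (∑ i, (X (m + 1) i s ω - limUnder atTop (fun k => X k i s ω)) ^ 2) ∂P +
            2 * ∫⁻ ω, ⨆ s ∈ Set.Iic T, ENNReal.ofReal (∑ i, (X (m + 1) i s ω - V i s ω) ^ 2) ∂P := by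
            rw [lintegral_add_left' ((hmeas m).const_mul _), lintegral_const_mul'' _ (hmeas m),
              lintegral_const_mul' _ _ (by norm_num)]
        _ ≤ _ := add_le_add le_rfl (mul_le_mul' le_rfl (hcontr.trans (mul_le_mul' le_rfl hIT)))
    -- let `m → ∞`
    have hCfin : Cst T ≠ ∞ := by
      simp only [hCst]
      exact ENNReal.add_ne_top.2 ⟨ENNReal.mul_ne_top (by simp) ENNReal.ofReal_ne_top,
        ENNReal.mul_ne_top (ENNReal.mul_ne_top (ENNReal.mul_ne_top (by norm_num) (by simp))
          (ENNReal.pow_ne_top (by simp))) ENNReal.ofReal_ne_top⟩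
    have hT0 : Tendsto (fun m : ℕ =>
        2 * ∫⁻ ω, ⨆ s ∈ Set.Iic T, ENNReal.ofReal
          (∑ i, (X (m + 1) i s ω - limUnder atTop (fun k => X k i s ω)) ^ 2) ∂P +
        2 * (Cst T * ((volume (Set.Icc (0 : ℝ) T)) * ∫⁻ ω, ⨆ s ∈ Set.Iic T, ENNReal.ofReal
          (∑ i, (X m i s ω - limUnder atTop (fun k => X k i s ω)) ^ 2) ∂P))) atTop (𝓝 0) := by
      have h1 : Tendsto (fun m : ℕ => 2 * ∫⁻ ω, ⨆ s ∈ Set.Iic T, ENNReal.ofReal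
          (∑ i, (X (m + 1) i s ω - limUnder atTop (fun k => X k i s ω)) ^ 2) ∂P) atTop (𝓝 0) := by
        simpa using ENNReal.Tendsto.const_mul (hlim.comp (tendsto_add_atTop_nat 1)) (Or.inr (by norm_num))
      have h2 : Tendsto (fun m : ℕ => 2 * (Cst T * ((volume (Set.Icc (0 : ℝ) T)) *
          ∫⁻ ω, ⨆ s ∈ Set.Iic T, ENNReal.ofReal
            (∑ i, (X m i s ω - limUnder atTop (fun k => X k i s ω)) ^ 2) ∂P))) atTop (𝓝 0) := by
        have h3 := ENNReal.Tendsto.const_mul hlim (a := volume (Set.Icc (0 : ℝ) T)) (Or.inr measure_Icc_lt_top.ne)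
        have h4 := ENNReal.Tendsto.const_mul h3 (a := Cst T) (Or.inr hCfin)
        have h5 := ENNReal.Tendsto.const_mul h4 (a := 2) (Or.inr (by norm_num))
        simpa using h5
      simpa using h1.add h2
    exact le_antisymm (ge_of_tendsto' hT0 hbound) bot_le
  -- from `Φ_T = 0` to indistinguishability
  have hae : ∀ T : ℕ, ∀ s ≤ (T : ℝ≥0), ∀ᵐ ω ∂P, ∀ i, limUnder atTop (fun m => X m i s ω) = V i s ω := by
    intro T s hs
    have h1 : ∫⁻ ω, ENNReal.ofReal (∑ i, (limUnder atTop (fun m => X m i s ω) - V i s ω) ^ 2) ∂P = 0 :=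
      le_antisymm ((lintegral_mono fun ω => le_iSup₂_of_le (f := fun s (_ : s ∈ Set.Iic (T : ℝ≥0)) =>
        ENNReal.ofReal (∑ i, (limUnder atTop (fun m => X m i s ω) - V i s ω) ^ 2)) s
          (Set.mem_Iic.2 hs) le_rfl).trans (hzero T).le) bot_le
    have hmeas : Measurable (fun ω => ENNReal.ofReal
        (∑ i, (limUnder atTop (fun m => X m i s ω) - V i s ω) ^ 2)) :=
      (Finset.measurable_sum _ fun i _ =>
        ((vecPicard_measurable (hLp i) s).sub (vecPicard_measurable (hVp i) s)).pow_const 2).ennreal_ofReal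
    filter_upwards [(lintegral_eq_zero_iff hmeas).1 h1] with ω hω i
    simp only [Pi.zero_apply, ENNReal.ofReal_eq_zero] at hω
    have hsum0 : ∑ j, (limUnder atTop (fun m => X m j s ω) - V j s ω) ^ 2 = 0 :=
      le_antisymm hω (Finset.sum_nonneg fun _ _ => sq_nonneg _)
    have hi := (Finset.sum_eq_zero_iff_of_nonneg fun j _ => sq_nonneg
      (limUnder atTop (fun m => X m j s ω) - V j s ω)).1 hsum0 i (Finset.mem_univ i)
    have := pow_eq_zero_iff (n := 2) two_ne_zero |>.1 hi
    linarith
  have hall : ∀ᵐ ω ∂P, ∀ q : ℚ, ∀ i,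
      limUnder atTop (fun m => X m i ((q : ℝ).toNNReal) ω) = V i ((q : ℝ).toNNReal) ω := by
    rw [ae_all_iff]; intro q
    exact hae ⌈(q : ℝ)⌉₊ _ (Real.toNNReal_le_iff_le_coe.2 (by rw [NNReal.coe_natCast]; exact Nat.le_ceil _))
  filter_upwards [hall, hLc, hVc] with ω h h1 h2 t i
  have := Continuous.ext_on denseRange_toNNReal_ratCast (h1 i) (h2 i) (by rintro _ ⟨q, rfl⟩; exact h q i)
  exact congrFun this t

end Sequence

/-- **Itô's existence theorem for Lipschitz systems driven by a Brownian vector.**  On any probability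
space carrying a Brownian vector `W` (tree `IsBrownianVec`, joint raw natural filtration `𝓕`), the system
`dX_i = b_i(X) dt + Σₙ σ_{i n}(X) dW^{c i n}` (`i ∈ ι`, `n ∈ κ` finite) with globally Lipschitz (sum-of-squares)
time-independent coefficients has, from every deterministic `x₀`, a solution `X` whose coordinates are
`𝓕`-progressive with a.s. continuous paths, in `L²(sup)` on bounded intervals, `X 0 = x₀`, with Itô integrals
`J i n = ∫ σ_{i n}(X) dW^{c i n}` (tree `IsItoIntegral`, square-integrable `𝓕`-martingales) and, almost surely
for all `t`, `X_i(t) = x₀ i + ∫₀ᵗ b_i(X_s) ds + Σₙ J i n (t)`.  Picard iteration (parts I–V).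
Revuz–Yor (1999), Ch. IX, Thm (2.1) (existence); K. Itô (1951). [cite: RevuzYor1999, Ch. IX Thm (2.1)] -/
theorem exists_vecSDE_solution [IsProbabilityMeasure P] (hW : IsBrownianVec W P)
    (b : (ι → ℝ) → ι → ℝ) (σ : (ι → ℝ) → ι → κ → ℝ) (c : ι → κ → Fin d) {K : ℝ} (hK : 0 ≤ K)
    (hb : ∀ x y : ι → ℝ, ∑ i, (b x i - b y i) ^ 2 ≤ K * ∑ i, (x i - y i) ^ 2)
    (hσ : ∀ x y : ι → ℝ, ∑ i, ∑ n, (σ x i n - σ y i n) ^ 2 ≤ K * ∑ i, (x i - y i) ^ 2)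
    (x₀ : ι → ℝ) :
    ∃ (X : ι → ℝ≥0 → Ω → ℝ) (J : ι → κ → ℝ≥0 → Ω → ℝ),
      (∀ i, IsStronglyProgressive hW.natFiltration (X i)) ∧
      (∀ᵐ ω ∂P, ∀ i, Continuous fun t => X i t ω) ∧
      (∀ t : ℝ≥0, ∫⁻ ω, ⨆ s ∈ Set.Iic t, ENNReal.ofReal (∑ i, X i s ω ^ 2) ∂P < ∞) ∧
      (∀ i ω, X i 0 ω = x₀ i) ∧
      (∀ i n, IsItoIntegral (fun s ω => σ (fun j => X j s ω) i n) (fun s ω => W s ω (c i n)) (J i n)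
          hW.natFiltration P ∧ Martingale (J i n) hW.natFiltration P ∧ ∀ t, MemLp (J i n t) 2 P) ∧
      ∀ᵐ ω ∂P, ∀ (t : ℝ≥0) (i : ι),
        X i t ω = x₀ i + (∫ s in (0 : ℝ)..t, b (fun j => X j s.toNNReal ω) i) + ∑ n, J i n t ω := by
  classical
  -- the invariant, as a subtype
  let T := {U : ι → ℝ≥0 → Ω → ℝ // (∀ i, IsStronglyProgressive hW.natFiltration (U i)) ∧
      (∀ᵐ ω ∂P, ∀ i, Continuous fun t => U i t ω) ∧
      ∀ t : ℝ≥0, ∫⁻ ω, ⨆ s ∈ Set.Iic t, ENNReal.ofReal (∑ i, U i s ω ^ 2) ∂P < ∞}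
  -- one Picard step, chosen once and for all
  have hstepEx : ∀ U : T, ∃ VJ : (ι → ℝ≥0 → Ω → ℝ) × (ι → κ → ℝ≥0 → Ω → ℝ),
      (∀ i n, IsItoIntegral (fun s ω => σ (fun j => U.1 j s ω) i n) (fun s ω => W s ω (c i n)) (VJ.2 i n)
          hW.natFiltration P ∧ Martingale (VJ.2 i n) hW.natFiltration P ∧ (∀ t, MemLp (VJ.2 i n t) 2 P) ∧
          IsStronglyProgressive hW.natFiltration (VJ.2 i n) ∧ ∀ ω, VJ.2 i n 0 ω = 0) ∧
      ∀ i t ω, VJ.1 i t ω = x₀ i + timeIntegral (fun s ω => b (fun j => U.1 j s ω) i) t ω + ∑ n, VJ.2 i n t ω := by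
    intro U
    obtain ⟨V, JV, h1, h2⟩ := vecPicard_step_exists (b := b) hW c hK hσ x₀ U.2.1 U.2.2.2
    exact ⟨(V, JV), h1, h2⟩
  choose Φ hΦ using hstepEx
  have hinv : ∀ U : T, (∀ i, IsStronglyProgressive hW.natFiltration ((Φ U).1 i)) ∧
      (∀ᵐ ω ∂P, ∀ i, Continuous fun t => (Φ U).1 i t ω) ∧
      ∀ t : ℝ≥0, ∫⁻ ω, ⨆ s ∈ Set.Iic t, ENNReal.ofReal (∑ i, (Φ U).1 i s ω ^ 2) ∂P < ∞ := fun U =>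
    ⟨vecPicard_step_progressive hW hK hb U.2.1 (fun i n => ((hΦ U).1 i n).2.2.2.1) (hΦ U).2,
      vecPicard_step_continuous hW hK hb U.2.2.1 (fun i n => ((hΦ U).1 i n).1) (hΦ U).2,
      fun t => vecPicard_step_sqIntegrable hW hK hb hσ U.2.1 U.2.2.1 U.2.2.2
        (fun i n => ⟨((hΦ U).1 i n).1, ((hΦ U).1 i n).2.2.2.1⟩) (hΦ U).2 t⟩
  let next : T → T := fun U => ⟨(Φ U).1, hinv U⟩
  let seq : ℕ → T := fun m => Nat.rec (motive := fun _ => T)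
    ⟨fun i _ _ => x₀ i, vecPicard_inv_const hW x₀⟩ (fun _ U => next U) m
  let X : ℕ → ι → ℝ≥0 → Ω → ℝ := fun m => (seq m).1
  let JX : ℕ → ι → κ → ℝ≥0 → Ω → ℝ := fun m => (Φ (seq m)).2
  have hX0 : ∀ i t ω, X 0 i t ω = x₀ i := fun _ _ _ => rfl
  have hXp : ∀ m i, IsStronglyProgressive hW.natFiltration (X m i) := fun m => (seq m).2.1
  have hXc : ∀ m, ∀ᵐ ω ∂P, ∀ i, Continuous fun t => X m i t ω := fun m => (seq m).2.2.1
  have hJX : ∀ m i n, IsItoIntegral (fun s ω => σ (fun j => X m j s ω) i n) (fun s ω => W s ω (c i n))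
      (JX m i n) hW.natFiltration P ∧ IsStronglyProgressive hW.natFiltration (JX m i n) := fun m i n =>
    ⟨((hΦ (seq m)).1 i n).1, ((hΦ (seq m)).1 i n).2.2.2.1⟩
  have hXs : ∀ m i t ω, X (m + 1) i t ω =
      x₀ i + timeIntegral (fun s ω => b (fun j => X m j s ω) i) t ω + ∑ n, JX m i n t ω := fun m i t ω =>
    (hΦ (seq m)).2 i t ω
  -- the limit and one more step
  have hLp : ∀ i, IsStronglyProgressive hW.natFiltration (fun t ω => limUnder atTop (fun m => X m i t ω)) :=
    vecPicard_isStronglyProgressive_lim hW hXp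
  have hLc : ∀ᵐ ω ∂P, ∀ i, Continuous fun t => limUnder atTop (fun m => X m i t ω) :=
    (vecPicard_ae_tendsto_lim hW hK hb hσ hX0 hXp hXc hJX hXs).mono fun _ h => h.1
  have hL2 : ∀ t : ℝ≥0, ∫⁻ ω, ⨆ s ∈ Set.Iic t, ENNReal.ofReal
      (∑ i, (limUnder atTop (fun m => X m i s ω)) ^ 2) ∂P < ∞ :=
    vecPicard_lim_sqIntegrable hW hK hb hσ hX0 hXp hXc hJX hXs
  obtain ⟨V, JV, hJV, hV⟩ := vecPicard_step_exists (b := b) hW c hK hσ x₀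
    (U := fun i t ω => limUnder atTop (fun m => X m i t ω)) hLp hL2
  have hfix := vecPicard_lim_eq_step hW hK hb hσ hX0 hXp hXc hJX hXs
    (fun i n => ⟨(hJV i n).1, (hJV i n).2.2.2.1⟩) hV
  refine ⟨fun i t ω => limUnder atTop (fun m => X m i t ω), JV, hLp, hLc, hL2,
    fun i ω => vecPicard_lim_apply_zero hW hX0 hJX hXs i ω,
    fun i n => ⟨(hJV i n).1, (hJV i n).2.1, (hJV i n).2.2.1⟩, ?_⟩
  filter_upwards [hfix] with ω hω t i
  rw [hω t i, hV i t ω]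
  rfl

end Summit.QuantumFields.YangMills.Theorems.ColdStartUniversality

end
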